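import Summits.RiemannHypothesis.RiemannHypothesis.Theorems.PfPersistenceFlooredTubes
import Summits.RiemannHypothesis.RiemannHypothesis.Theorems.PfPersistenceGalerkinNesting
import Summits.RiemannHypothesis.RiemannHypothesis.Theorems.PfPersistenceFloorRateDichotomy
import Summits.RiemannHypothesis.RiemannHypothesis.Theorems.WeilWindowFlowGronwallLeakageStrictAnti
import Summits.RiemannHypothesis.RiemannHypothesis.Theorems.GroundBartaPolarPerronFrobeniusThetaQuasimode
import HarnessLib

/-!
# PF persistence — THE MARGIN BAND IS EMPTY and W2 IS UNCONDITIONAL (cell `pub-rhpf`, barrier-typer gen 10)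

long-odds MECHANISM SEARCH; no RH claims.  Everything below is PROVED (Mathlib + tree theorems; no `sorry`,
no named fact used as a hypothesis); statements carrying `RiemannHypothesis` are labelled RH-EQUIVALENCE and are
readings of the typed table, never claims about `ζ`.

Typed answer to ADJ-LOG QUESTION A294 (c) ("does `HeightFlooredPositive ζ` get its own GAP-CLASSES row — the
MARGIN BAND `{AllWindowsPositive ζ ∧ ¬ HeightFlooredPositive ζ}` between the saturated column and the dial column
of THE EXISTENCE TABLE, `PfPersistenceFlooredTubes.existence_table_saturated` / `existence_table_dial`?").

Answer (RH-free, kernel-checked): **NO ROW — THE BAND IS EMPTY.**  With cand-3's Galerkin ↔ continuum dictionary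
(`PfPersistenceGalerkinNesting`: `⨅_N ε₁^{(N)}(a) = ε_ev(a)`) the two ends of the table are read in `ε_ev` language,
* `AllWindowsPositive ζ   ↔ ∀ a > 0, 0 ≤ ε_ev(a)`   (`allWindowsPositive_zeta_iff_weilEvenGroundEnergy_nonneg`),
* `HeightFlooredPositive ζ ↔ ∀ a > 0, 0 < ε_ev(a)`  (`heightFlooredPositive_zeta_iff_weilEvenGroundEnergy_pos`;
  the optimal floor below height `A` is EXACTLY `ε_ev(A)`, `isGLB_bottomRayleigh_below_height`),
and the non-strict family of inequalities already implies the strict one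
(`weilEvenGroundEnergy_pos_of_forall_nonneg`: a floor `0` on `a ≥ 1` bounds every zero onto the line by the tree's
floor-rate dictionary, which certifies `WeilPositivityOn (a+1)`, and the window bottom `ε` is STRICTLY decreasing, so
`0 < ε(a) ≤ ε_ev(a)`).  Hence
* `heightFlooredPositive_zeta_iff_allWindowsPositive` : `HeightFlooredPositive ζ ↔ AllWindowsPositive ζ`;
* `zeta_mem_strictPositiveClass_iff_allWindowsPositive` : `ζ ∈ P⁺ ↔ AllWindowsPositive ζ`;
* `existence_table` : on EVERY domain `D ∋ ζ` and in each of the four typed strata (window-wise open, G1-int,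
  G1-cont, G1-contU) a separating criterion EXISTS iff `AllWindowsPositive ζ` — the table has lost its domain
  dependence, and `zeta_dichotomy` : `ζ` is either detectably negative or height-floored positive (never marginal).

Second consequence (CLASS.md §4.3 W2, CASE-DAG B-W2 / B-TYPED-2): the Galerkin UPPER LAW `GalerkinInfZero ζ`, so far
a TYPED input of the uniform-modulus barrier, is PROVED (`galerkinInfZero_zeta`: continuum theta-quasimode law
`ε_ev(a) ≤ e^{-3e^{2a}}` + the truncation ladder `exists_bottomRayleigh_lt`), making
`negativesAccumulateNe_univ_zeta`, `negativesAccumulateNe_dialSpace_zeta` and `not_separates_of_uniformlyRobustAt_zeta`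
UNCONDITIONAL: no criterion with an `a`-uniform modulus of continuity at `ζ` separates `ζ` on any domain containing
the dial space.  Labels: PROVED = kernel-checked here; RH-EQUIVALENCE = an `↔ RiemannHypothesis` reading.
-/

set_option linter.dupNamespace false  -- the mandated namespace repeats `RiemannHypothesis`

namespace Summit.RiemannHypothesis.RiemannHypothesis.Theorems.PfPersistence

open Literature.NumberTheory.LFunctions Matrix Filter
open Summit.RiemannHypothesis.RiemannHypothesis.Theorems.PfPersistenceFloorRateDichotomy
  (riemannHypothesis_of_weilEvenGroundEnergy_bddBelow weilEvenGroundEnergy_nonneg_of_riemannHypothesis')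
open Summit.RiemannHypothesis.RiemannHypothesis.Theorems.WeilWindowFlowGronwallLeakage
  (weilGroundEnergy_pos_of_weilPositivityOn_of_lt)
open Summit.RiemannHypothesis.RiemannHypothesis.Theorems.PolarPerronFrobenius
  (weilEvenGroundEnergy_le_exp_neg_mul_exp)

/-! ## §1 The two ends of the existence table in `ε_ev` language (RH-free) -/

/-- PROVED: `0 < vᵀv` for `v ≠ 0` (local copy). [folklore] -/
private theorem dotSelf_pos' {k : ℕ} {v : Fin k → ℝ} (hv : v ≠ 0) : 0 < v ⬝ᵥ v :=
  lt_of_le_of_ne (dotProduct_self_nonneg_real v) fun h0 => hv (dotProduct_self_eq_zero.1 h0.symm)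

/-- **PROVED (RH-free): `ζ` is all-window positive iff `ε_ev(a) ≥ 0` at every half-length `a > 0`.** [folklore] -/
theorem allWindowsPositive_zeta_iff_weilEvenGroundEnergy_nonneg :
    AllWindowsPositive zetaDatum ↔ ∀ a : ℝ, 0 < a → 0 ≤ weilEvenGroundEnergy a := by
  refine ⟨fun h a ha => ?_, fun h win v => ?_⟩
  · exact le_weilEvenGroundEnergy_of_forall_le_bottomRayleigh ha fun N =>
      le_bottomRayleigh_of_forall _ fun v hv => div_nonneg (h ⟨a, N, ha⟩ v) (dotProduct_self_nonneg_real v)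
  · have hb : 0 ≤ bottomRayleigh (zetaDatum win) :=
      (h win.a win.ha).trans (weilEvenGroundEnergy_le_bottomRayleigh' win)
    exact (mul_nonneg hb (dotProduct_self_nonneg_real v)).trans (bottomRayleigh_mul_le_form _ v)

/-- **PROVED (RH-free): below height `A > 0` every window bottom of `ζ` is at least `ε_ev(A)`** (`ε_ev` is
non-increasing and every truncation is an upper rung). [folklore] -/
theorem weilEvenGroundEnergy_le_bottomRayleigh_of_le {A : ℝ} (win : Window) (hA : win.a ≤ A) :
    weilEvenGroundEnergy A ≤ bottomRayleigh (zetaDatum win) :=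
  (weilEvenGroundEnergy_antitone win.ha hA).trans (weilEvenGroundEnergy_le_bottomRayleigh' win)

/-- **PROVED (RH-free) — THE OPTIMAL BOUNDED-HEIGHT FLOOR IS `ε_ev(A)`:** for `A > 0`, `ε_ev(A)` is the greatest lower
bound of the window bottoms `ε₁(ζ(a, N))` over all windows of height `a ≤ A` (all truncations). [folklore] -/
theorem isGLB_bottomRayleigh_below_height {A : ℝ} (hA : 0 < A) :
    IsGLB {r : ℝ | ∃ win : Window, win.a ≤ A ∧ r = bottomRayleigh (zetaDatum win)} (weilEvenGroundEnergy A) := by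
  refine ⟨?_, fun b hb => ?_⟩
  · rintro r ⟨win, hwin, rfl⟩
    exact weilEvenGroundEnergy_le_bottomRayleigh_of_le win hwin
  · refine le_of_forall_pos_lt_add fun δ hδ => ?_
    obtain ⟨N, hN⟩ := exists_bottomRayleigh_lt hA hδ
    exact (hb ⟨⟨A, N, hA⟩, le_rfl, rfl⟩).trans_lt hN

/-- **PROVED (RH-free): `ζ` is height-floored positive iff `ε_ev(a) > 0` at every half-length `a > 0`** — and then
the floor below height `A` may be taken to be `ε_ev(A)` itself. [folklore] -/
theorem heightFlooredPositive_zeta_iff_weilEvenGroundEnergy_pos :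
    HeightFlooredPositive zetaDatum ↔ ∀ a : ℝ, 0 < a → 0 < weilEvenGroundEnergy a := by
  rw [heightFlooredPositive_iff_bottomRayleigh]
  refine ⟨fun h a ha => ?_, fun h A => ?_⟩
  · obtain ⟨m, hm, hmw⟩ := h a
    exact hm.trans_le (le_weilEvenGroundEnergy_of_forall_le_bottomRayleigh ha fun N => hmw ⟨a, N, ha⟩ le_rfl)
  · rcases le_or_gt A 0 with hA | hA
    · exact ⟨1, one_pos, fun win hwin => absurd (win.ha.trans_le (hwin.trans hA)) (lt_irrefl 0)⟩
    · exact ⟨weilEvenGroundEnergy A, h A hA, fun win hwin => weilEvenGroundEnergy_le_bottomRayleigh_of_le win hwin⟩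

/-! ## §2 The collapse: non-strict positivity of `ε_ev` already forces strict positivity -/

/-- CONDITIONAL (RH-STRENGTH hypothesis; no RH claim): under RH every even ground energy at `a > 0` is STRICTLY
positive — RH certifies `WeilPositivityOn (a + 1)`, the window bottom `ε` is strictly decreasing, `ε ≤ ε_ev`. [folklore] -/
theorem weilEvenGroundEnergy_pos_of_riemannHypothesis' (hRH : RiemannHypothesis) {a : ℝ} (ha : 0 < a) :
    0 < weilEvenGroundEnergy a :=
  (weilGroundEnergy_pos_of_weilPositivityOn_of_lt
      (WeilPositivityOn.of_riemannHypothesis explicit_formula_holds hRH (a + 1)) ha (lt_add_one a)).trans_le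
    (weilGroundEnergy_le_weilEvenGroundEnergy a)

/-- **PROVED (an implication between two RH-free families of inequalities): if `ε_ev(a) ≥ 0` for every `a > 0` then
`ε_ev(a) > 0` for every `a > 0`.**  (The floor `0` on `a ≥ 1` puts every non-trivial zero on the line by the tree's
floor-rate dictionary; then the previous lemma.) [folklore] -/
theorem weilEvenGroundEnergy_pos_of_forall_nonneg (h : ∀ a : ℝ, 0 < a → 0 ≤ weilEvenGroundEnergy a) {a : ℝ}
    (ha : 0 < a) : 0 < weilEvenGroundEnergy a :=
  weilEvenGroundEnergy_pos_of_riemannHypothesis'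
    (riemannHypothesis_of_weilEvenGroundEnergy_bddBelow (L := 0) (a₀ := 1) fun b hb => h b (one_pos.trans_le hb)) ha

/-- PROVED: so the two families are EQUIVALENT. [folklore] -/
theorem forall_weilEvenGroundEnergy_nonneg_iff_pos :
    (∀ a : ℝ, 0 < a → 0 ≤ weilEvenGroundEnergy a) ↔ ∀ a : ℝ, 0 < a → 0 < weilEvenGroundEnergy a :=
  ⟨fun h _ ha => weilEvenGroundEnergy_pos_of_forall_nonneg h ha, fun h a ha => (h a ha).le⟩

/-- **PROVED (RH-free): `ε_ev` never merely TOUCHES zero** — a zero of `ε_ev` at some `a > 0` forces a NEGATIVE value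
at some `b > 0`. [folklore] -/
theorem exists_weilEvenGroundEnergy_neg_of_eq_zero {a : ℝ} (ha : 0 < a) (h0 : weilEvenGroundEnergy a = 0) :
    ∃ b : ℝ, 0 < b ∧ weilEvenGroundEnergy b < 0 := by
  by_contra hne
  push Not at hne
  exact (weilEvenGroundEnergy_pos_of_forall_nonneg hne ha).ne' h0

/-! ## §3 THE MARGIN BAND IS EMPTY -/

/-- **PROVED — HEADLINE (RH-free): `HeightFlooredPositive ζ ↔ AllWindowsPositive ζ`.**  The saturated column and
the dial column of THE EXISTENCE TABLE coincide: the margin band `AllWindowsPositive ζ ∧ ¬ HeightFlooredPositive ζ`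
is EMPTY. [folklore] -/
theorem heightFlooredPositive_zeta_iff_allWindowsPositive :
    HeightFlooredPositive zetaDatum ↔ AllWindowsPositive zetaDatum :=
  ⟨HeightFlooredPositive.allWindowsPositive, fun h =>
    heightFlooredPositive_zeta_iff_weilEvenGroundEnergy_pos.2 fun _ ha =>
      weilEvenGroundEnergy_pos_of_forall_nonneg (allWindowsPositive_zeta_iff_weilEvenGroundEnergy_nonneg.1 h) ha⟩

/-- PROVED: the margin band is empty (set-difference form). [folklore] -/
theorem marginBand_empty : ¬ (AllWindowsPositive zetaDatum ∧ ¬ HeightFlooredPositive zetaDatum) :=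
  fun ⟨h, hn⟩ => hn (heightFlooredPositive_zeta_iff_allWindowsPositive.2 h)

/-- **PROVED (RH-free): `ζ ∈ P⁺ ↔ AllWindowsPositive ζ`** — for `ζ`, window-wise strict positivity costs nothing
beyond positivity. [folklore] -/
theorem zeta_mem_strictPositiveClass_iff_allWindowsPositive :
    zetaDatum ∈ strictPositiveClass ↔ AllWindowsPositive zetaDatum :=
  ⟨fun h => strictPositiveClass_subset_positiveClass h,
    fun h => (heightFlooredPositive_zeta_iff_allWindowsPositive.2 h).mem_strictPositiveClass⟩

/-- **PROVED (RH-free) — THE `ζ`-DICHOTOMY:** `ζ` is either DETECTABLY NEGATIVE (some window, some truncation, some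
vector with a negative form value) or HEIGHT-FLOORED POSITIVE (a positive Loewner floor `ε_ev(A)` below every height
`A`, uniformly in `N`).  There is no marginal third case. [folklore] -/
theorem zeta_dichotomy : DetectablyNegative zetaDatum ∨ HeightFlooredPositive zetaDatum := by
  by_cases h : AllWindowsPositive zetaDatum
  · exact Or.inr (heightFlooredPositive_zeta_iff_allWindowsPositive.2 h)
  · exact Or.inl ((detectablyNegative_iff_not_allWindowsPositive zetaDatum).2 h)

/-- PROVED: and the two cases exclude each other. [folklore] -/
theorem heightFlooredPositive_zeta_iff_not_detectablyNegative :
    HeightFlooredPositive zetaDatum ↔ ¬ DetectablyNegative zetaDatum := by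
  rw [heightFlooredPositive_zeta_iff_allWindowsPositive, detectablyNegative_iff_not_allWindowsPositive, not_not]

/-! ## §4 THE EXISTENCE TABLE on every domain -/

/-- **PROVED — THE EXISTENCE TABLE, EVERY DOMAIN `D ∋ ζ` (RH-free):** in each of the four typed strata (window-wise
open, G1-int, G1-cont, G1-contU) a criterion separating `ζ` from the negatives of `D` EXISTS iff `ζ` is all-window
positive.  (Gen 9 had this for `D ⊆ dialSpace` and, with `ζ ∈ P⁺` / `HeightFlooredPositive ζ` on the right, for
saturated `D`; §3 identifies all right-hand sides.) [folklore] -/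
theorem existence_table (D : Set Datum) (hζ : zetaDatum ∈ D) :
    ((∃ S, IsWindowwiseOpen S ∧ Separates S D zetaDatum) ↔ AllWindowsPositive zetaDatum) ∧
    ((∃ S, InG1int S ∧ Separates S D zetaDatum) ↔ AllWindowsPositive zetaDatum) ∧
    ((∃ S, InG1cont S ∧ Separates S D zetaDatum) ↔ AllWindowsPositive zetaDatum) ∧
    ((∃ S, InG1contU S ∧ Separates S D zetaDatum) ↔ AllWindowsPositive zetaDatum) := by
  obtain ⟨h1, h2, h3, h4⟩ := existence_chain D hζ
  have hU : AllWindowsPositive zetaDatum → ∃ S, InG1contU S ∧ Separates S D zetaDatum :=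
    fun h => h1 (heightFlooredPositive_zeta_iff_allWindowsPositive.2 h)
  have hI : AllWindowsPositive zetaDatum → ∃ S, InG1int S ∧ Separates S D zetaDatum := fun h =>
    (exists_inG1int_separates_iff D).2
      (boxIsolated_of_mem_strictPositiveClass (zeta_mem_strictPositiveClass_iff_allWindowsPositive.2 h) D)
  exact ⟨⟨h4, fun h => h3 (h2 (hU h))⟩, ⟨fun ⟨_, _, hsep⟩ => hsep.allWindowsPositive hζ, hI⟩,
    ⟨fun h => h4 (h3 h), fun h => h2 (hU h)⟩, ⟨fun h => h4 (h3 (h2 h)), hU⟩⟩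

/-- PROVED: in particular the four strata are EXISTENCE-EQUIVALENT on every domain containing `ζ` (the strictest,
G1-contU, separates as soon as the laxest, window-wise open, does). [folklore] -/
theorem exists_inG1contU_separates_iff_exists_windowwiseOpen (D : Set Datum) (hζ : zetaDatum ∈ D) :
    (∃ S, InG1contU S ∧ Separates S D zetaDatum) ↔ ∃ S, IsWindowwiseOpen S ∧ Separates S D zetaDatum :=
  (existence_table D hζ).2.2.2.trans (existence_table D hζ).1.symm

/-! ## §5 RH-EQUIVALENCE readings (labels only; no RH claim) -/

/-- RH-EQUIVALENCE (no RH claim): `AllWindowsPositive ζ ↔ RH` (`→` is the tree's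
`riemannHypothesis_of_allWindowsPositive'`; `←` is Weil positivity under RH read at the window bottoms). [folklore] -/
theorem allWindowsPositive_zeta_iff_riemannHypothesis : AllWindowsPositive zetaDatum ↔ RiemannHypothesis :=
  ⟨riemannHypothesis_of_allWindowsPositive', fun hRH =>
    allWindowsPositive_zeta_iff_weilEvenGroundEnergy_nonneg.2 fun a _ =>
      weilEvenGroundEnergy_nonneg_of_riemannHypothesis' hRH a⟩

/-- RH-EQUIVALENCE (no RH claim): `HeightFlooredPositive ζ ↔ RH`. [folklore] -/
theorem heightFlooredPositive_zeta_iff_riemannHypothesis : HeightFlooredPositive zetaDatum ↔ RiemannHypothesis :=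
  heightFlooredPositive_zeta_iff_allWindowsPositive.trans allWindowsPositive_zeta_iff_riemannHypothesis

/-- RH-EQUIVALENCE (no RH claim): on every domain `D ∋ ζ`, a G1-contU criterion separating `ζ` EXISTS iff RH — the
existence question of the admissible-class programme is RH itself, in every stratum and on every domain. [folklore] -/
theorem exists_inG1contU_separates_iff_riemannHypothesis (D : Set Datum) (hζ : zetaDatum ∈ D) :
    (∃ S, InG1contU S ∧ Separates S D zetaDatum) ↔ RiemannHypothesis :=
  (existence_table D hζ).2.2.2.trans allWindowsPositive_zeta_iff_riemannHypothesis

/-! ## §6 The Galerkin upper law is PROVED: W2 unconditional -/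

/-- **PROVED (RH-free): `ε_ev` takes arbitrarily small values** (theta-quasimode law `ε_ev(a) ≤ e^{-3 e^{2a}}` for
large `a`). [folklore] -/
theorem exists_weilEvenGroundEnergy_lt {δ : ℝ} (hδ : 0 < δ) : ∃ a : ℝ, 0 < a ∧ weilEvenGroundEnergy a < δ := by
  obtain ⟨a₀, ha₀⟩ := weilEvenGroundEnergy_le_exp_neg_mul_exp (c := 3) (by linarith [Real.pi_gt_three])
  have hev : ∀ᶠ x : ℝ in atTop, Real.exp (-x) < δ :=
    Real.tendsto_exp_neg_atTop_nhds_zero.eventually (gt_mem_nhds hδ)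
  obtain ⟨a, ⟨ha0, haa₀⟩, hδa⟩ := (((eventually_gt_atTop 0).and (eventually_ge_atTop a₀)).and hev).exists
  refine ⟨a, ha0, (ha₀ a haa₀).trans_lt (lt_of_le_of_lt (Real.exp_le_exp.2 ?_) hδa)⟩
  have h1 := Real.add_one_le_exp (2 * a)
  linarith

/-- **PROVED — THE GALERKIN UPPER LAW `GalerkinInfZero ζ` (was TYPED; now a theorem):** for every `δ > 0` some window
and some coefficient vector have `vᵀ ζ_w v < δ · vᵀv` — small continuum energy (§6) plus the truncation ladder
`ε₁^{(N)}(a) ↓ ε_ev(a)` (`exists_bottomRayleigh_lt`). [folklore] -/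
theorem galerkinInfZero_zeta : GalerkinInfZero zetaDatum := by
  intro δ hδ
  obtain ⟨a, ha, hlt⟩ := exists_weilEvenGroundEnergy_lt (half_pos hδ)
  obtain ⟨N, hN⟩ := exists_bottomRayleigh_lt ha (half_pos hδ)
  have hb : bottomRayleigh (zetaDatum ⟨a, N, ha⟩) < δ := by linarith
  obtain ⟨v, hv, hq⟩ := exists_rayleigh_lt_of_bottomRayleigh_lt _ hb
  exact ⟨⟨a, N, ha⟩, v, (div_lt_iff₀ (dotSelf_pos' hv)).1 hq⟩

/-- **PROVED — W2 UNCONDITIONAL, full domain:** detectably negative operators other than `ζ` accumulate uniformly at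
`ζ` (the shifts `ζ − ε·1`). [folklore] -/
theorem negativesAccumulateNe_univ_zeta : NegativesAccumulateNe Set.univ zetaDatum :=
  negativesAccumulateNe_univ_of_galerkinInfZero galerkinInfZero_zeta

/-- **PROVED — W2 UNCONDITIONAL, dial space:** detectably negative PRIME TABLES other than `ζ` accumulate uniformly
at `ζ` (the `q = 1` weight shifts of `PfPersistenceF6SpectralShift`). [folklore] -/
theorem negativesAccumulateNe_dialSpace_zeta : NegativesAccumulateNe dialSpace zetaDatum :=
  F6Shift.negativesAccumulateNe_dialSpace_of_galerkinInfZero galerkinInfZero_zeta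

/-- **PROVED — THE UNIFORM-MODULUS BARRIER, UNCONDITIONAL:** a criterion that is uniformly robust at `ζ` (contains
every datum uniformly `ε`-close to `ζ` in form, some `ε > 0`) CONTAINS a detectably negative prime table `≠ ζ`; hence
it separates `ζ` on NO domain containing the dial space. [folklore] -/
theorem uniformlyRobustAt_contains_negative_zeta {S : Set Datum} (hS : UniformlyRobustAt S zetaDatum) :
    ∃ d ∈ dialSpace, d ≠ zetaDatum ∧ d ∈ S ∧ DetectablyNegative d :=
  not_uniformlyRobust_of_negativesAccumulateNe negativesAccumulateNe_dialSpace_zeta hS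

/-- PROVED: the separation form of the unconditional uniform-modulus barrier. [folklore] -/
theorem not_separates_of_uniformlyRobustAt_zeta {S D : Set Datum} (hD : dialSpace ⊆ D)
    (hS : UniformlyRobustAt S zetaDatum) : ¬ Separates S D zetaDatum := by
  rintro ⟨-, hneg⟩
  obtain ⟨d, hdD, -, hdS, hd⟩ := uniformlyRobustAt_contains_negative_zeta hS
  exact hneg d (hD hdD) hd hdS

end Summit.RiemannHypothesis.RiemannHypothesis.Theorems.PfPersistence
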